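import Mathlib
import Literature.NumberTheory.Kottwitz1992.FixedPointCount
import Literature.NumberTheory.Kottwitz1986BaseChangeUnits.MainResult
import HarnessLib

/-!
# Kottwitz (1986), *Base change for unit elements of Hecke algebras* — the Introduction's set-up
# (pp. 237–239) as subgroup-level vocabulary over `G(L)`, the (C)(D) ∕ (C′)(D′) rewritings of §1
# (p. 242) and PROPOSITION 2 of §2 (pp. 246–247), AS A TYPED DICTIONARY — ED. 3: every named
# fact of this file DISCHARGED (`_holds`, §3)

Source: R. E. Kottwitz, *Base change for unit elements of Hecke algebras*, Compositio Math. **60**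
(1986) 237–250 (bib `Kottwitz1986BaseChangeUnits`).  Open copy of record: NUMDAM item
`CM_1986__60_2_237_0` (lit store key `paper:url-52c464c05c51`; PDF page `n` = printed page
`235 + n`).  The text layer of that PDF drops every displayed formula, so all formulas below were
read off the PDF's own page scans, decoded losslessly to
`run/shared/lean/pub/hodgecm-mathlib/T/KOT/TK-t12/g0/Kottwitz1986BaseChangeUnits-NUMDAM/img/p0237…p0250.png`
(image `pNNNN.png` IS printed page `NNN`); page pins `(p. N)` are PRINTED pages.

Carpet-typing squad TK (cell `pub/hodgecm-mathlib`, GO 500, seat TK-t12; TK-plan DEAL v3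
2026-09-02T02:19Z, co-deal ruling 02:24:50Z, overlap ruling 02:37:28Z).  Every printed statement
is a `Prop`-valued `def` with its page anchor (no `sorry`, no axiom, no instance, no notation); **ED. 3
(paydown, TK-plan DEAL v4.1 P-a, ruling 02:30:26Z «in-carpet `_holds` is the norm») appends §3: the
four named facts of §2 are PROVED** (`Kottwitz1986BaseChangeUnits_1_AB_iff_CD_holds`,
`_1_AB_iff_CD_primed_holds`, `_2_prop2_concrete_holds`, `_2_indep_of_j_b_holds`; pure group algebra in
Mathlib's `SemidirectProduct` over ★ MainResult's `SD σ`, no new definitions, no new facts), so this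
file carries NO undischarged fact.

**ED. 2 (consolidation (a), TK-plan ruling 2026-09-02T02:37:28Z).**  §1 «Main result» (pp. 239–244)
is OWNED by ★ `Literature.NumberTheory.Kottwitz1986BaseChangeUnits.MainResult` (TK-t08, p848072):
the correspondence `γ ↔ δ` by (A), (B) (`CondAB`, `Corr`), (A′)(B′) (`corr_iff_primed`), the norm
`normElt` with (C′) (`norm_eq_conj`), «`δ` exists iff (A′)» ∕ its `θ`-class (`exists_delta_iff`,
`corr_delta_unique`), «`γ` exists iff (D′)» ∕ its class (`exists_gamma_iff`, `corr_gamma_unique`),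
«enough corresponding elements» (`exists_delta_of_fixedCoset`, `exists_gamma_of_fixedCoset`), the
fixed-point descriptions of p. 240 (`FixedCosets_sigma`, `FixedCosets_sigmaPow`), the transports of
p. 241 (`centralizer_transport`, `fixedCoset_transport`), and over its skeleton `OrbitalDatum` the
THEOREM (p. 243), `signs_equal`, the COROLLARY and its Supplement (p. 244).  ED. 1 of this file
(p848123) had typed the same §1 rows in parallel (`Kottwitz1986BaseChangeUnits_1_AB_iff_primed`,
`_1_fixedPoints_of_sigma`, `_1_fixedPoints_bijOn`, `_1_centralizer_bijOn`, `_1_exists_delta_iff`,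
`_1_delta_unique`, `_1_exists_gamma_iff`, `_1_gamma_unique`, `_1_norm_eq_conj`,
`_1_exists_delta_of_fixX`, `_1_exists_gamma_of_fixXE`, `_1_theorem_fixedPoints`): **these twelve rows
are DROPPED here — §1 rows: see ★ `MainResult` (TK-t08)** — and the parallel posits of ED. 1 are now
ALIASES of MainResult's (`SatisfiesAB := CondAB`, `Corresponds := Corr`, `KLConditions := KLCondA ∧
KLCondB ∧ KLCondC`; ED. 1's own copy `semidirect`/`sd` of the semidirect product is dropped in favour
of MainResult's `SD σ`, `frobElt σ`).  What this file keeps is what MainResult does not carry: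

* §1 of this file — the Introduction's objects as SUBGROUP-LEVEL vocabulary over an abstract group
  `G = G(L)` with Frobenius `σ : MulAut G` (consumed by the companion ★ `UnitOrbitalIntegrals.lean`):
  the `l`-fold norm `iterNorm` («`Nδ = δθ(δ)θ²(δ)…θ^{l-1}(δ)`», p. 237; MainResult's `normElt` is the
  same element presented as `((δσ^j)^l σ^{-jl}).left`), the subgroups `ptsF σ = G(F)`, `ptsE σ l = G(E)`
  (the subgroups cut out by MainResult's predicates `IsRatF`, `IsRatE`), conjugacy ∕ `θ`-conjugacy
  UNDER A SUBGROUP (`IsConjUnder`, `IsTwConjUnder`; at `H = G(F)`, `G(E)` these are MainResult's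
  `IsConjF`, `IsThetaConj` up to `g ↦ g⁻¹`, and at `H = G_γ(L)`, `θ = σ` the `σ`-conjugacy of p. 246),
  the fixed-point SETS `X^γ`, `X_E^{δθ} ⊂ X_L = G(L)/K_L` (`fixedCosets`, `fixX`, `fixXE`; MainResult
  works with representatives), `K`, `K_E`, `G_γ(F)`, `I_{δθ}(F)` as subgroups (`subK`, `subKE`,
  `centF`, `centTw` — the latter over the tree's ★ `Kottwitz1992.FixedPointCount.twistedCentralizer`)
  and the unit elements `f = 1_K`, `f_E = 1_{K_E}` (`unitF`, `unitE`, p. 240; «the unit element of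
  `ℋ_E`, namely, the characteristic function of `K_E` … `b(f_E)` is the unit element of `ℋ`», p. 239).
* §2 of this file — the named facts MainResult does not state: the EQUIVALENCES «(A), (B) are
  equivalent to (C), (D)» and «We can rewrite (C), (D) as (C′), (D′)» (p. 242) as `iff`s
  (`Kottwitz1986BaseChangeUnits_1_AB_iff_CD`, `_1_AB_iff_CD_primed`; MainResult has (C′) as the
  implication `norm_eq_conj` and (D′) inside `exists_gamma_iff`), and PROPOSITION 2 (pp. 246–247) in its
  concrete form `γ′ = gγg⁻¹`, `g⁻¹σ(g) = γ^{-n}` with its corollary «independent of `j, b`» (p. 246).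
* §3 of this file (ED. 3) — the DISCHARGES: an abstract «inverting the matrix `[a l; b j]`» lemma for
  two commuting elements of any group (p. 242), the bookkeeping `σ^n g σ^{-n} = σ^n(g)` and
  `(δσ^j)^n = N_n(δ) σ^{jn}` in `G(L) ⋊ ⟨σ⟩`, and from these the four `_holds` theorems — Kottwitz's
  own computations of pp. 241–242 and 246–247, kernel-checked.

p. 237 (the set-up): «Let `G` be a connected reductive group over a `p`-adic field `F` and assume that
`G` is unramified (that is, quasi-split over `F` and split over an unramified extension of `F`).  Let
`E` be a finite unramified extension of `F`, let `θ` be a generator of `Gal(E/F)`, and let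
`l = [E : F]`.  Consider a hyperspecial point `x₀` in the building of `G` over `F`.  We denote by `K`
the stabilizer of `x₀` in `G(F)` and by `ℋ = ℋ(G(F), K)` the corresponding Hecke algebra.  Of course
`x₀` also gives rise to `K_E ⊂ G(E)` and `ℋ_E = ℋ(G(E), K_E)`.  There is a canonical homorphism
[sic] `b : ℋ_E → ℋ`, characterized by the following property: `tr π_φ(b(f)) = tr π_ψ(f)` for all
`f ∈ ℋ_E` and all unramified admissible homomorphisms `φ : W_F → ᴸG`.» … «There are two forms of the
norm mapping.  The first is the mapping `N : G(E) → G(E)` defined by `Nδ = δθ(δ)θ²(δ)…θ^{l-1}(δ)`.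
The second is a mapping `𝒩` from `G(E)` to the set of stable conjugacy classes in `G(F)`» (p. 238: «By
definition, `𝒩δ` is the stable conjugacy class of `γ`», `γ ∈ G(F)` in the `G(F̄)`-class of `Nδ`).
p. 239 (§1): «Let `L` denote the completion of the maximal unramified extension `E^un` of `E`.  We have
`E^un = F^un` and we denote by `σ` the Frobenius automorphism of `L` over `F`.»

NOT typed here (said, not hidden): the Hecke algebras `ℋ`, `ℋ_E` and the base change homomorphism `b`
with its Satake characterisation (p. 237; the statements only use `b(1_{K_E}) = 1_K`, p. 239); the
topology («open bounded subgroup», p. 240); the invariant `inv(γ, γ′)` and `B(G_γ)` through which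
PROPOSITION 2 is printed (pp. 246–247) — only its concrete content is typed; §4 «Groups `G` for which
`G_der` is not simply connected» (pp. 249–250: a sketch with no numbered statement).  The analytic
objects (orbital integrals, signs, stable classes, `κ`, Arthur's weight `v_M`) are POSITED in the
companion file `UnitOrbitalIntegrals.lean` (and, for §1, in MainResult's `OrbitalDatum`).

DEDUP (content words, 2026-09-02): besides ★ MainResult, `rg 'Kottwitz1986BaseChangeUnits'` → 3 tree
files, all READERS of this paper inside the Arthur (2013) audit (`Automorphic/Arthur2013/Leaves/
WeightedFLPrint.lean` §§8/18, `WeightedFLPrint2.lean` §1, `TwistedPrincipalSlice.lean` §5 `Kt1Sec3`)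
— registers and scope records, nothing restated here.  Norm maps in the tree: ★
`Automorphic.ArthurClozel.normMap` (`GL_n(E)`, entrywise Galois action), ★ `Rogawski1990.Ch4Sec12.normMap`
(`l = 2`), ★ `MainResult.normElt` (the semidirect-product presentation); `iterNorm` is the printed
ordered product.  ★ `Rogawski1990.Ch4Sec12.fixedSubgroup ε` is `ε.eqLocus id`; `ptsF`/`ptsE` are the two
specific instances written directly over Mathlib's `MonoidHom.eqLocus` (that module's import cone is
§4.10–4.12 of Rogawski, not wanted here).  ★ `Ch4Sec12.IsEpsConj` quantifies the conjugator over the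
ambient group; here `θ`-conjugacy is UNDER A SUBGROUP of `G(L)` (`IsTwConjUnder`).

HONEST LABEL: HC_CM is proved only modulo the 7 printed citations (2 remaining: hLiu418 =
stmt-HodgeConjecture-24832, h413 = stmt-HodgeConjecture-24833) until rung 0 closes.
-/

namespace Literature.NumberTheory.Kottwitz1986BaseChangeUnits.UnitBaseChange

open Literature.NumberTheory.Kottwitz1992.FixedPointCount (twistedCentralizer)
open Literature.NumberTheory.Kottwitz1986BaseChangeUnits.MainResult
open SemidirectProduct

universe u

/-! ## §1 The Introduction's objects as subgroup-level vocabulary over `G(L)` with Frobenius `σ` -/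

section Concrete

variable {G : Type u} [Group G]

/-- **The `l`-fold norm of an automorphism `θ`**: `iterNorm θ l δ = δ θ(δ) θ²(δ) ⋯ θ^{l-1}(δ)`
(«`Nδ = δθ(δ)θ²(δ)…θ^{l-1}(δ)`», p. 237): the ordered product of the list
`[δ, θ(δ), …, θ^{l-1}(δ)]` (`List.prod`, left to right; empty product `1` for `l = 0` — in print
`l = [E : F] ≥ 1`; the signatures of this file allow `l = 0`, harmlessly).  With `θ = σ^j` this is the
element MainResult presents as `normElt σ l j δ = ((δσ^j)^l σ^{-jl}).left` ((C), p. 242; see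
`delta_pow` in §3).
[cite: Kottwitz1986BaseChangeUnits, Introduction p. 237] -/
def iterNorm (θ : MulAut G) (l : ℕ) (δ : G) : G :=
  ((List.range l).map fun i => (θ ^ i) δ).prod

/-- **`G(F) = G(L)^σ`** as a subgroup of `G(L)` — the elements with MainResult's `IsRatF σ g`, i.e.
`σ g = g` (p. 239 «we denote by `σ` the Frobenius automorphism of `L` over `F`»; p. 242 «(C) and (D)
imply that `γ, σ` commute and hence that `γ ∈ G(F)`»).  Mathlib's `MonoidHom.eqLocus`.
[cite: Kottwitz1986BaseChangeUnits, §1 pp. 239, 242] -/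
def ptsF (σ : MulAut G) : Subgroup G :=
  σ.toMonoidHom.eqLocus (MonoidHom.id G)

/-- **`G(E) = G(L)^{σ^l}`** as a subgroup of `G(L)`, `l = [E : F]` — the elements with MainResult's
`IsRatE σ l g` (p. 241 «which implies that `σ^l, δσ^j` commute, and this in turn implies that
`δ ∈ G(E)`»). [cite: Kottwitz1986BaseChangeUnits, §1 pp. 239, 241] -/
def ptsE (σ : MulAut G) (l : ℕ) : Subgroup G :=
  (σ ^ l).toMonoidHom.eqLocus (MonoidHom.id G)

/-- **Conjugacy under a subgroup `H`**: `γ′ = h γ h⁻¹` for some `h ∈ H` («`γ, γ′` are conjugate in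
`G(F)`», p. 242; at `H = ptsF σ` this is MainResult's `IsConjF σ γ γ′`).
[cite: Kottwitz1986BaseChangeUnits, §1 p. 242] -/
def IsConjUnder (H : Subgroup G) (γ γ' : G) : Prop :=
  ∃ h ∈ H, γ' = h * γ * h⁻¹

/-- **`θ`-conjugacy under a subgroup `H`**: `δ′ = h⁻¹ δ θ(h)` for some `h ∈ H` («`δ, δ′` are
`θ`-conjugate under `G(E)`», p. 241 — at `H = ptsE σ l`, `θ = σ^j` this is MainResult's
`IsThetaConj σ l j δ δ′` with `g = h⁻¹`; at `H = G_γ(L)`, `θ = σ` it is the `σ`-conjugacy in `G_γ(L)`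
of PROPOSITION 2, p. 246). [cite: Kottwitz1986BaseChangeUnits, §1 p. 241; §2 p. 246] -/
def IsTwConjUnder (H : Subgroup G) (θ : MulAut G) (δ δ' : G) : Prop :=
  ∃ h ∈ H, δ' = h⁻¹ * δ * θ h

/-- **«`γ, δ, c` satisfy (A) and (B)»** (p. 241: (A) `cγ^aσ^lc⁻¹ = σ^l`, (B) `cγ^bσ^jc⁻¹ = δσ^j` in
`G(L) ⋊ ⟨σ⟩`) — ALIAS of ★ `MainResult.CondAB` (ED. 2; ED. 1 carried its own copy), kept under this
name because the companion ★ `UnitOrbitalIntegrals.lean` consumes it.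
[cite: Kottwitz1986BaseChangeUnits, §1 p. 241] -/
def SatisfiesAB (σ : MulAut G) (l j : ℕ) (a b : ℤ) (γ δ c : G) : Prop :=
  CondAB σ l j a b γ δ c

/-- **The correspondence `γ ↔ δ`** (p. 241: «We write `γ ↔ δ` if there exists `c ∈ G(L)` such that
the following two conditions hold: (A) … (B) …») — ALIAS of ★ `MainResult.Corr`.
[cite: Kottwitz1986BaseChangeUnits, §1 p. 241] -/
def Corresponds (σ : MulAut G) (l j : ℕ) (a b : ℤ) (γ δ : G) : Prop :=
  Corr σ l j a b γ δ

/-- **Fixed cosets in `X_L = G(L)/K_L`** as a SET: the cosets `x = gK_L` with `g₀ τ(x) = x`, i.e.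
`g⁻¹ g₀ τ(g) ∈ K_L` (p. 240: «Writing `x` for `gK_E ∈ X_E`, we have `g⁻¹δθ(g) ∈ K_E` if and only if
`δθx = x`»; `g₀ = 1`: the fixed points of the automorphism `τ`; `τ = 1`: those of the group element
`g₀`).  Written with a representative; independent of it when `τ(K_L) = K_L` (condition (a), p. 240).
MainResult phrases the same conditions on representatives `g`. [cite: Kottwitz1986BaseChangeUnits, §1 p. 240] -/
def fixedCosets (KL : Subgroup G) (τ : MulAut G) (g₀ : G) : Set (G ⧸ KL) :=
  {x | ∃ g : G, (QuotientGroup.mk g : G ⧸ KL) = x ∧ g⁻¹ * g₀ * τ g ∈ KL}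

/-- **`X^γ`, «the set of fixed points of `γ` on `X`»** (p. 241) inside `X_L` (`X = G(F)/K` is the fixed
point set of `σ` on `X_L` by condition (b), p. 240): the cosets fixed by `σ` and by `γ`.
[cite: Kottwitz1986BaseChangeUnits, §1 pp. 240–241] -/
def fixX (σ : MulAut G) (KL : Subgroup G) (γ : G) : Set (G ⧸ KL) :=
  fixedCosets KL σ 1 ∩ fixedCosets KL 1 γ

/-- **`X_E^{δθ}`, «the set of fixed points of `δθ` on `X_E`»** (p. 240) inside `X_L` (`X_E = G(E)/K_E`
is the fixed point set of `σ^l`; «`θ` acts on `X_E` (by some power of `σ`)», namely `σ^j`): the cosets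
fixed by `σ^l` and by `δσ^j`. [cite: Kottwitz1986BaseChangeUnits, §1 p. 240] -/
def fixXE (σ : MulAut G) (l j : ℕ) (KL : Subgroup G) (δ : G) : Set (G ⧸ KL) :=
  fixedCosets KL (σ ^ l) 1 ∩ fixedCosets KL (σ ^ j) δ

/-- **The three conditions (a), (b), (c) on `K_L ⊂ G(L)`** (p. 240: «(a) `σ(K_L) = K_L`. (b) The
mapping `k ↦ k⁻¹σ(k)` from `K_L` to `K_L` is surjective. (c) The mapping `k ↦ k⁻¹σ^l(k)` from `K_L` to
`K_L` is surjective.») — the CONJUNCTION of ★ MainResult's `KLCondA`, `KLCondB`, `KLCondC` (ED. 2;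
ED. 1 had a parallel `structure`).  «Open bounded» is not typed.
[cite: Kottwitz1986BaseChangeUnits, §1 p. 240] -/
def KLConditions (σ : MulAut G) (l : ℕ) (KL : Subgroup G) : Prop :=
  KLCondA σ KL ∧ KLCondB σ KL ∧ KLCondC σ l KL

/-- **`K = G(F) ∩ K_L`** («Let `K` (resp. `K_E`) be `G(F) ∩ K_L` (resp. `G(E) ∩ K_L`)», p. 240).
[cite: Kottwitz1986BaseChangeUnits, §1 p. 240] -/
def subK (σ : MulAut G) (KL : Subgroup G) : Subgroup G :=
  ptsF σ ⊓ KL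

/-- **`K_E = G(E) ∩ K_L`** (p. 240). [cite: Kottwitz1986BaseChangeUnits, §1 p. 240] -/
def subKE (σ : MulAut G) (l : ℕ) (KL : Subgroup G) : Subgroup G :=
  ptsE σ l ⊓ KL

/-- **`G_γ(F)`**, the centraliser of `γ` in `G(F)` (p. 238 «a choice of Haar measure `dt` on
`G_γ(F)`»; p. 241), as the subgroup `G(F) ∩ Cent_{G(L)}(γ)` of `G(L)` (MainResult's
`centralizer_transport` phrases its transport to `I_{δθ}(F)` elementwise).
[cite: Kottwitz1986BaseChangeUnits, Introduction p. 238; §1 p. 241] -/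
def centF (σ : MulAut G) (γ : G) : Subgroup G :=
  ptsF σ ⊓ Subgroup.centralizer ({γ} : Set G)

/-- **`I_{δθ}(F)`**, «simply the twisted centralizer of `δ` in `G(E)`» (p. 238), i.e.
`{g ∈ G(E) : g⁻¹ δ θ(g) = δ}` with `θ = σ^j`: `G(E) ∩` the tree's ★ `twistedCentralizer` of `δ` for
`σ^j`. [cite: Kottwitz1986BaseChangeUnits, Introduction p. 238; §1 p. 241] -/
def centTw (σ : MulAut G) (l j : ℕ) (δ : G) : Subgroup G :=
  ptsE σ l ⊓ twistedCentralizer (σ ^ j).toMonoidHom δ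

/-- **`f`, «the characteristic function of `K`» in `G(F)`** (p. 240; = `b(f_E)`, «the unit element of
`ℋ`», p. 239), as a function on `G(L)` (junk `0` off `G(F)`). [cite: Kottwitz1986BaseChangeUnits, §1 p. 240] -/
noncomputable def unitF (σ : MulAut G) (KL : Subgroup G) : G → ℂ :=
  (subK σ KL : Set G).indicator fun _ => 1

/-- **`f_E`, «the characteristic function of `K_E`» in `G(E)`** (p. 240; «the unit element of `ℋ_E`»,
p. 239). [cite: Kottwitz1986BaseChangeUnits, §1 p. 240] -/
noncomputable def unitE (σ : MulAut G) (l : ℕ) (KL : Subgroup G) : G → ℂ :=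
  (subKE σ l KL : Set G).indicator fun _ => 1

end Concrete

/-! ## §2 The rewritings (C)(D), (C′)(D′) of §1 and PROPOSITION 2 of §2 (named facts; group theory only) -/

section ConcreteFacts

variable {G : Type u} [Group G]

/-- **«Inverting the matrix `[a l; b j]`, we see that (A), (B) are equivalent to
(C) `(δσ^j)^l σ^{-jl} = cγc⁻¹`, (D) `(δσ^j)^{-a} σ^{bl} = cσc⁻¹`»** (p. 242), as an EQUIVALENCE, for
`γ ∈ G(F)`, `δ ∈ G(E)` («of course we are using that `γ, σ` commute and that `σ^l, δσ^j` commute») and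
`bl − aj = 1`; the equations live in MainResult's `SD σ = G(L) ⋊ ⟨σ⟩` with `frobElt σ = σ`.
[cite: Kottwitz1986BaseChangeUnits, §1 p. 242] -/
def Kottwitz1986BaseChangeUnits_1_AB_iff_CD (σ : MulAut G) (l j : ℕ) (a b : ℤ) : Prop :=
  b * l - a * j = 1 →
    ∀ γ ∈ ptsF σ, ∀ δ ∈ ptsE σ l, ∀ c : G, SatisfiesAB σ l j a b γ δ c ↔
      ((inl δ * frobElt σ ^ j) ^ (l : ℤ) * (frobElt σ ^ ((j : ℤ) * l))⁻¹ =
          inl c * inl γ * (inl c)⁻¹ ∧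
        (inl δ * frobElt σ ^ j) ^ (-a) * frobElt σ ^ (b * l) = inl c * frobElt σ * (inl c)⁻¹)

/-- **«We can rewrite (C), (D) as (C′) `Nδ = cγc⁻¹`, (D′) `(δσ^j)^{-a}σ^{aj} = cσ(c⁻¹)`»** (p. 242), as
an EQUIVALENCE with (A), (B): for `γ ∈ G(F)`, `δ ∈ G(E)`, `bl − aj = 1`, the pair (A), (B) holds for `c`
iff `Nδ = cγc⁻¹` (with `N` the printed ordered product `iterNorm (σ^j) l`) and
`(δσ^j)^{-a}σ^{aj} = cσ(c)⁻¹` in `G(L) ⋊ ⟨σ⟩`.  (MainResult carries (C′) as the implication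
`norm_eq_conj` and (D′) inside `exists_gamma_iff`.) [cite: Kottwitz1986BaseChangeUnits, §1 p. 242] -/
def Kottwitz1986BaseChangeUnits_1_AB_iff_CD_primed (σ : MulAut G) (l j : ℕ) (a b : ℤ) : Prop :=
  b * l - a * j = 1 →
    ∀ γ ∈ ptsF σ, ∀ δ ∈ ptsE σ l, ∀ c : G, SatisfiesAB σ l j a b γ δ c ↔
      (iterNorm (σ ^ j) l δ = c * γ * c⁻¹ ∧
        (inl δ * frobElt σ ^ j) ^ (-a) * frobElt σ ^ ((a : ℤ) * j) = (inl (c * σ c⁻¹) : SD σ))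

/-- **PROPOSITION 2 (pp. 246–247), concrete form.** «suppose that we have `γ, γ′ ∈ G(F)`,
`δ ∈ G(E)`, `c, c′ ∈ G(L)` such that `γ, δ, c` satisfy (A), (B) for `j, a, b` and `γ′, δ, c′` satisfy
(A), (B) for `j′, a′, b′`» with «`a′ = a + nl`», «`j′ = j + ml`; then `b′ = b + nj + ma + mnl`».  «We have
`cγc⁻¹ = Nδ = c′γ′(c′)⁻¹`, and hence `γ′ = gγg⁻¹`, where `g = (c′)⁻¹c`» and, with `x = g⁻¹σ(g)`,
«We will now show that `x = γ^{-n}`» (p. 247).  The printed PROPOSITION 2 — «The image of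
`inv(γ, γ′)` in `B(G_γ)` is equal to the `σ`-conjugacy class of `γ^{-n}` in `G_γ(L)`» («The set
`B(G_γ)` can be identified with the set of `σ`-conjugacy classes in `G_γ(L)`», p. 246) — is this
identity read through `H¹(F, G_γ) ↪ B(G_γ)` (for `γ` semisimple), which is not typed.
[cite: Kottwitz1986BaseChangeUnits, §2 Proposition 2 pp. 246–247] -/
def Kottwitz1986BaseChangeUnits_2_prop2_concrete (σ : MulAut G) (l : ℕ) : Prop :=
  ∀ (j j' : ℕ) (a b a' b' n m : ℤ), b * l - a * j = 1 → b' * l - a' * j' = 1 →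
    a' = a + n * l → (j' : ℤ) = j + m * l →
    ∀ γ ∈ ptsF σ, ∀ γ' ∈ ptsF σ, ∀ δ ∈ ptsE σ l, ∀ c c' : G,
      SatisfiesAB σ l j a b γ δ c → SatisfiesAB σ l j' a' b' γ' δ c' →
        γ' = (c'⁻¹ * c) * γ * (c'⁻¹ * c)⁻¹ ∧ (c'⁻¹ * c)⁻¹ * σ (c'⁻¹ * c) = γ ^ (-n)

/-- **«the correspondence is independent of `j, b`, but is dependent on `a`»** (p. 246): for two
admissible choices `(j, a, b)`, `(j′, a, b′)` with the SAME `a` (and `j ≡ j′ mod l`), `γ ↔ δ` and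
`γ′ ↔ δ` for `γ, γ′ ∈ G(F)`, `δ ∈ G(E)` force `γ, γ′` conjugate in `G(F)` (the case `n = 0` of
PROPOSITION 2: `g⁻¹σ(g) = 1`, i.e. `g ∈ G(F)`). [cite: Kottwitz1986BaseChangeUnits, §2 pp. 246–247] -/
def Kottwitz1986BaseChangeUnits_2_indep_of_j_b (σ : MulAut G) (l : ℕ) : Prop :=
  ∀ (j j' : ℕ) (a b b' m : ℤ), b * l - a * j = 1 → b' * l - a * j' = 1 → (j' : ℤ) = j + m * l →
    ∀ γ ∈ ptsF σ, ∀ γ' ∈ ptsF σ, ∀ δ ∈ ptsE σ l,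
      Corresponds σ l j a b γ δ → Corresponds σ l j' a b' γ' δ → IsConjUnder (ptsF σ) γ γ'

end ConcreteFacts


/-! ## §3 Discharges (`_holds`) of the concrete named facts of §2 — pure group algebra in `G(L) ⋊ ⟨σ⟩` -/

section Holds

variable {G : Type u} [Group G]

/-! ### Auxiliary algebra for two commuting elements -/

/-- For commuting `x, y`: `(x^p y^q)(x^r y^s) = x^{p+r} y^{q+s}` (private helper). [folklore] -/
private theorem zpowPair_mul {S : Type*} [Group S] {x y : S} (h : Commute x y) (p q r s : ℤ) :
    (x ^ p * y ^ q) * (x ^ r * y ^ s) = x ^ (p + r) * y ^ (q + s) := by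
  rw [zpow_add, zpow_add]
  have hc : y ^ q * x ^ r = x ^ r * y ^ q := ((h.zpow_zpow r q).eq).symm
  calc (x ^ p * y ^ q) * (x ^ r * y ^ s) = x ^ p * ((y ^ q * x ^ r) * y ^ s) := by
        simp only [mul_assoc]
    _ = x ^ p * ((x ^ r * y ^ q) * y ^ s) := by rw [hc]
    _ = x ^ p * x ^ r * (y ^ q * y ^ s) := by simp only [mul_assoc]

/-- For commuting `x, y`: `(x^p y^q)^n = x^{pn} y^{qn}` (private helper). [folklore] -/
private theorem zpowPair_zpow {S : Type*} [Group S] {x y : S} (h : Commute x y) (p q n : ℤ) :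
    (x ^ p * y ^ q) ^ n = x ^ (p * n) * y ^ (q * n) := by
  rw [(h.zpow_zpow p q).mul_zpow, ← zpow_mul, ← zpow_mul]

/-- The abstract «inverting the matrix» step (p. 242): for commuting `Γ, F`, any `u, Δ` and
`bl − aj = 1`, (A) `u Γ^a F^l u⁻¹ = F^l` ∧ (B) `u Γ^b F^j u⁻¹ = Δ` iff `Δ` commutes with `F^l` and
(C) `u Γ u⁻¹ = Δ^l F^{-jl}` ∧ (D) `u F u⁻¹ = Δ^{-a} F^{bl}` (private helper).
[cite: Kottwitz1986BaseChangeUnits, §1 p. 242] -/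
private theorem ab_iff_cd_abstract {S : Type*} [Group S] (Γ F Δ u : S) (a b j l : ℤ)
    (hΓF : Commute Γ F) (hab : b * l - a * j = 1) :
    (u * (Γ ^ a * F ^ l) * u⁻¹ = F ^ l ∧ u * (Γ ^ b * F ^ j) * u⁻¹ = Δ) ↔
      (Commute Δ (F ^ l) ∧ u * Γ * u⁻¹ = Δ ^ l * F ^ (-(j * l)) ∧
        u * F * u⁻¹ = Δ ^ (-a) * F ^ (b * l)) := by
  -- conjugation by `u` as a multiplicative equivalence
  let ψ : S ≃* S := MulAut.conj u
  have hψ : ∀ x : S, u * x * u⁻¹ = ψ x := fun x => (MulAut.conj_apply u x).symm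
  simp only [hψ]
  constructor
  · rintro ⟨hA, hB⟩
    -- `Δ` and `F^l` commute, being images of commuting elements
    have hXY : Commute (Γ ^ a * F ^ l) (Γ ^ b * F ^ j) := by
      refine Commute.mul_left (Commute.mul_right ?_ ?_) (Commute.mul_right ?_ ?_)
      · exact (Commute.refl Γ).zpow_zpow a b
      · exact hΓF.zpow_zpow a j
      · exact (hΓF.zpow_zpow b l).symm
      · exact (Commute.refl F).zpow_zpow l j
    have hΔFl : Commute Δ (F ^ l) := by
      rw [← hA, ← hB]
      exact (hXY.symm).map ψ
    refine ⟨hΔFl, ?_, ?_⟩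
    · -- Γ = (Γ^a F^l)^(-j) (Γ^b F^j)^l
      have hΓ : Γ = (Γ ^ a * F ^ l) ^ (-j) * (Γ ^ b * F ^ j) ^ l := by
        rw [zpowPair_zpow hΓF, zpowPair_zpow hΓF, zpowPair_mul hΓF]
        have e1 : a * -j + b * l = 1 := by linear_combination hab
        have e2 : l * -j + j * l = 0 := by ring
        rw [e1, e2, zpow_one, zpow_zero, mul_one]
      rw [hΓ, map_mul, map_zpow, map_zpow, hA, hB]
      rw [(hΔFl.symm.zpow_zpow (-j) l).eq, ← zpow_mul]
      congr 2
      ring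
    · -- F = (Γ^a F^l)^b (Γ^b F^j)^(-a)
      have hF : F = (Γ ^ a * F ^ l) ^ b * (Γ ^ b * F ^ j) ^ (-a) := by
        rw [zpowPair_zpow hΓF, zpowPair_zpow hΓF, zpowPair_mul hΓF]
        have e1 : a * b + b * -a = 0 := by ring
        have e2 : l * b + j * -a = 1 := by linear_combination hab
        rw [e1, e2, zpow_one, zpow_zero, one_mul]
      rw [hF, map_mul, map_zpow, map_zpow, hA, hB]
      rw [(hΔFl.symm.zpow_zpow b (-a)).eq, ← zpow_mul]
      congr 2
      ring
  · rintro ⟨hΔFl, hC, hD⟩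
    -- write everything over the commuting pair `(Δ, F^l)`
    have hC' : ψ Γ = Δ ^ (l : ℤ) * (F ^ l) ^ (-j) := by
      rw [hC, ← zpow_mul]; congr 2; ring
    have hD' : ψ F = Δ ^ (-a) * (F ^ l) ^ b := by
      rw [hD, ← zpow_mul]; congr 2; ring
    constructor
    · rw [map_mul, map_zpow, map_zpow, hC', hD', zpowPair_zpow hΔFl, zpowPair_zpow hΔFl,
        zpowPair_mul hΔFl]
      have e1 : (l : ℤ) * a + -a * l = 0 := by ring
      have e2 : -j * a + b * l = 1 := by linear_combination hab
      rw [e1, e2, zpow_zero, zpow_one, one_mul]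
    · rw [map_mul, map_zpow, map_zpow, hC', hD', zpowPair_zpow hΔFl, zpowPair_zpow hΔFl,
        zpowPair_mul hΔFl]
      have e1 : (l : ℤ) * b + -a * j = 1 := by linear_combination hab
      have e2 : -j * b + b * j = 0 := by ring
      rw [e1, e2, zpow_zero, zpow_one, mul_one]

end Holds


section HoldsSD

variable {G : Type u} [Group G]

/-- `frobHom σ (ofAdd n) = σ^n` (unfolding ★ MainResult's `frobHom = zpowersHom`; private helper). [folklore] -/
private theorem ubc_frobHom_ofAdd (σ : MulAut G) (n : ℤ) :
    frobHom σ (Multiplicative.ofAdd n) = σ ^ n := by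
  rw [frobHom, zpowersHom_apply, toAdd_ofAdd]

/-- `σ^n = inr (ofAdd n)` in `G(L) ⋊ ⟨σ⟩` (private helper). [folklore] -/
private theorem ubc_frobElt_pow (σ : MulAut G) (n : ℕ) :
    frobElt σ ^ n = (inr (Multiplicative.ofAdd (n : ℤ)) : SD σ) := by
  rw [frobElt, ← map_pow, ← ofAdd_nsmul, Nat.smul_one_eq_cast]

/-- `σ^n g σ^{-n} = σ^n(g)` in `G(L) ⋊ ⟨σ⟩` (p. 241 «the semidirect product of `G(L)` and the
infinite cyclic group `⟨σ⟩`»; private helper). [cite: Kottwitz1986BaseChangeUnits, §1 p. 241] -/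
private theorem frobElt_pow_mul_inl (σ : MulAut G) (n : ℕ) (g : G) :
    frobElt σ ^ n * inl g = inl ((σ ^ n) g) * frobElt σ ^ n := by
  rw [ubc_frobElt_pow]
  have h := inl_aut (φ := frobHom σ) (Multiplicative.ofAdd (n : ℤ)) g
  rw [ubc_frobHom_ofAdd, zpow_natCast] at h
  rw [h, map_inv, inv_mul_cancel_right]

/-- `σ g = σ(g) σ` in `G(L) ⋊ ⟨σ⟩` (private helper). [folklore] -/
private theorem frobElt_mul_inl (σ : MulAut G) (g : G) :
    frobElt σ * inl g = inl (σ g) * frobElt σ := by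
  simpa using frobElt_pow_mul_inl σ 1 g

/-- «`γ, σ` commute» for `γ ∈ G(F)` (p. 242; private helper). [cite: Kottwitz1986BaseChangeUnits, §1 p. 242] -/
private theorem commute_inl_frobElt {σ : MulAut G} {γ : G} (hγ : γ ∈ ptsF σ) :
    Commute (inl γ : SD σ) (frobElt σ) := by
  have h1 := frobElt_mul_inl σ γ
  have hγ' : σ γ = γ := hγ
  rw [hγ'] at h1
  exact h1.symm

/-- «`σ^l, δσ^j` commute» for `δ ∈ G(E)` (p. 242; private helper). [cite: Kottwitz1986BaseChangeUnits, §1 p. 242] -/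
private theorem commute_delta_frobElt_pow {σ : MulAut G} {l : ℕ} (j : ℕ) {δ : G}
    (hδ : δ ∈ ptsE σ l) :
    Commute (inl δ * frobElt σ ^ j : SD σ) (frobElt σ ^ l) := by
  have h1 := frobElt_pow_mul_inl σ l δ
  have hδ' : (σ ^ l) δ = δ := hδ
  rw [hδ'] at h1
  have hc : Commute (inl δ : SD σ) (frobElt σ ^ l) := h1.symm
  exact hc.mul_left ((Commute.refl (frobElt σ)).pow_pow j l)

/-- `N_0(δ) = 1` (empty product; private helper). [folklore] -/
private theorem iterNorm_zero (θ : MulAut G) (δ : G) : iterNorm θ 0 δ = 1 := by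
  simp [iterNorm]

/-- `N_{n+1}(δ) = N_n(δ) θ^n(δ)` (private helper). [folklore] -/
private theorem iterNorm_succ (θ : MulAut G) (n : ℕ) (δ : G) :
    iterNorm θ (n + 1) δ = iterNorm θ n δ * (θ ^ n) δ := by
  simp [iterNorm, List.range_succ]

/-- `(δσ^j)^n = N_n(δ) σ^{jn}` with `N_n` the ordered `n`-fold norm for `θ = σ^j` ((C) ↔ (C′), p. 242;
private helper). [cite: Kottwitz1986BaseChangeUnits, §1 p. 242] -/
private theorem delta_pow (σ : MulAut G) (j : ℕ) (δ : G) (n : ℕ) :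
    (inl δ * frobElt σ ^ j : SD σ) ^ n = inl (iterNorm (σ ^ j) n δ) * frobElt σ ^ (j * n) := by
  induction n with
  | zero => rw [pow_zero, iterNorm_zero, map_one, Nat.mul_zero, pow_zero, one_mul]
  | succ n ih =>
    rw [pow_succ, ih, iterNorm_succ, map_mul, Nat.mul_succ, pow_add, ← pow_mul]
    calc inl (iterNorm (σ ^ j) n δ) * frobElt σ ^ (j * n) * (inl δ * frobElt σ ^ j)
        = inl (iterNorm (σ ^ j) n δ) * (frobElt σ ^ (j * n) * inl δ) * frobElt σ ^ j := by
          simp only [mul_assoc]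
      _ = inl (iterNorm (σ ^ j) n δ) * (inl ((σ ^ (j * n)) δ) * frobElt σ ^ (j * n)) *
            frobElt σ ^ j := by rw [frobElt_pow_mul_inl]
      _ = inl (iterNorm (σ ^ j) n δ) * inl ((σ ^ (j * n)) δ) *
            (frobElt σ ^ (j * n) * frobElt σ ^ j) := by simp only [mul_assoc]

/-- **Discharge of `Kottwitz1986BaseChangeUnits_1_AB_iff_CD`** ((A)(B) ⟺ (C)(D), p. 242): matrix
inversion in the abelian subgroup generated by `γ` and `σ`. [cite: Kottwitz1986BaseChangeUnits, §1 p. 242] -/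
theorem Kottwitz1986BaseChangeUnits_1_AB_iff_CD_holds :
    ∀ {G : Type u} [Group G] (σ : MulAut G) (l j : ℕ) (a b : ℤ),
      Kottwitz1986BaseChangeUnits_1_AB_iff_CD σ l j a b := by
  intro G _ σ l j a b hab γ hγ δ hδ c
  have hΓF := commute_inl_frobElt hγ
  have hΔ := commute_delta_frobElt_pow j hδ
  have key := ab_iff_cd_abstract (inl γ : SD σ) (frobElt σ) (inl δ * frobElt σ ^ j) (inl c)
    a b (j : ℤ) (l : ℤ) hΓF hab
  rw [zpow_natCast, zpow_natCast] at key
  simp only [SatisfiesAB, CondAB, mul_assoc] at key ⊢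
  rw [key, zpow_neg]
  constructor
  · rintro ⟨-, hC, hD⟩
    exact ⟨hC.symm, hD.symm⟩
  · rintro ⟨hC, hD⟩
    exact ⟨hΔ, hC.symm, hD.symm⟩

/-- **Discharge of `Kottwitz1986BaseChangeUnits_1_AB_iff_CD_primed`** ((A)(B) ⟺ (C′)(D′), p. 242).
[cite: Kottwitz1986BaseChangeUnits, §1 p. 242] -/
theorem Kottwitz1986BaseChangeUnits_1_AB_iff_CD_primed_holds :
    ∀ {G : Type u} [Group G] (σ : MulAut G) (l j : ℕ) (a b : ℤ),
      Kottwitz1986BaseChangeUnits_1_AB_iff_CD_primed σ l j a b := by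
  intro G _ σ l j a b hab γ hγ δ hδ c
  rw [Kottwitz1986BaseChangeUnits_1_AB_iff_CD_holds σ l j a b hab γ hγ δ hδ c]
  have hC : ((inl δ * frobElt σ ^ j : SD σ) ^ (l : ℤ) * (frobElt σ ^ ((j : ℤ) * l))⁻¹ =
        inl c * inl γ * (inl c)⁻¹) ↔ iterNorm (σ ^ j) l δ = c * γ * c⁻¹ := by
    have e : ((j : ℤ) * l) = ((j * l : ℕ) : ℤ) := by push_cast; ring
    rw [zpow_natCast, delta_pow, e, zpow_natCast, mul_inv_cancel_right, ← map_mul, ← map_inv,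
      ← map_mul, inl_inj]
  have hD : ((inl δ * frobElt σ ^ j : SD σ) ^ (-a) * frobElt σ ^ (b * (l : ℤ)) =
        inl c * frobElt σ * (inl c)⁻¹) ↔
      ((inl δ * frobElt σ ^ j : SD σ) ^ (-a) * frobElt σ ^ ((a : ℤ) * j) = inl (c * σ c⁻¹)) := by
    have e : (inl c : SD σ) * frobElt σ * (inl c)⁻¹ = inl (c * σ c⁻¹) * frobElt σ := by
      rw [map_mul, mul_assoc, mul_assoc, ← map_inv, frobElt_mul_inl]
    have e2 : (b : ℤ) * l = a * j + 1 := by linear_combination hab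
    rw [e, e2, zpow_add_one, ← mul_assoc, mul_left_inj]
  rw [hC, hD]

end HoldsSD


section HoldsProp2

variable {G : Type u} [Group G]

/-- `F^{kl} = (F^l)^k` for `l : ℕ`, `k : ℤ` (private helper). [folklore] -/
private theorem fpow_mul_natl {S : Type*} [Group S] (F : S) (l : ℕ) (k : ℤ) :
    F ^ (k * l) = (F ^ l) ^ k := by
  rw [mul_comm, zpow_mul, zpow_natCast]

/-- `(x^p y^q) y^s = x^p y^{q+s}` (private helper). [folklore] -/
private theorem zpowPair_mul_right {S : Type*} [Group S] (x y : S) (p q s : ℤ) :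
    (x ^ p * y ^ q) * y ^ s = x ^ p * y ^ (q + s) := by
  rw [mul_assoc, ← zpow_add]

/-- **Discharge of `Kottwitz1986BaseChangeUnits_2_prop2_concrete`** (PROPOSITION 2, pp. 246–247, in
its concrete form): with `g = c′⁻¹c`, `γ′ = gγg⁻¹` and `g⁻¹σ(g) = γ^{-n}` — Kottwitz's computation
«using (D) for `c′` … replacing `j′` by `j + ml` … replacing `a′` by `a + nl` and then using (C) and
(D) for `c`» carried out in `G(L) ⋊ ⟨σ⟩`. [cite: Kottwitz1986BaseChangeUnits, §2 Proposition 2 pp. 246–247] -/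
theorem Kottwitz1986BaseChangeUnits_2_prop2_concrete_holds :
    ∀ {G : Type u} [Group G] (σ : MulAut G) (l : ℕ),
      Kottwitz1986BaseChangeUnits_2_prop2_concrete σ l := by
  intro G _ σ l j j' a b a' b' n m hab hab' ha' hj' γ hγ γ' hγ' δ hδ c c' h1 h2
  have hΓF := commute_inl_frobElt hγ
  have hΓ'F := commute_inl_frobElt hγ'
  have hΔ := commute_delta_frobElt_pow j hδ
  -- (C), (D) for both systems
  have key1 := ab_iff_cd_abstract (inl γ : SD σ) (frobElt σ) (inl δ * frobElt σ ^ j) (inl c)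
    a b (j : ℤ) (l : ℤ) hΓF hab
  have key2 := ab_iff_cd_abstract (inl γ' : SD σ) (frobElt σ) (inl δ * frobElt σ ^ j') (inl c')
    a' b' (j' : ℤ) (l : ℤ) hΓ'F hab'
  rw [zpow_natCast, zpow_natCast] at key1 key2
  simp only [SatisfiesAB, CondAB, mul_assoc] at h1 h2 key1 key2
  obtain ⟨-, hC1, hD1⟩ := key1.1 h1
  obtain ⟨-, hC2, hD2⟩ := key2.1 h2
  -- abbreviations: `Δ = δσ^j`, `Y = σ^l`; `Δ' = δσ^{j'} = Δ Y^m`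
  have hY : Commute (inl δ * frobElt σ ^ j : SD σ) (frobElt σ ^ l) := hΔ
  have hΔ' : (inl δ * frobElt σ ^ j' : SD σ) =
      (inl δ * frobElt σ ^ j) ^ (1 : ℤ) * (frobElt σ ^ l) ^ m := by
    rw [zpow_one, mul_assoc, ← fpow_mul_natl, ← zpow_natCast (frobElt σ) j',  hj', zpow_add,
      zpow_natCast]
  -- rewrite all `F`-powers whose exponent is a multiple of `l` as powers of `Y = F^l`
  have e1 : (-(↑j * ↑l) : ℤ) = (-(j : ℤ)) * l := by ring
  have e2 : (-(↑j' * ↑l) : ℤ) = (-(j' : ℤ)) * l := by ring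
  rw [e1, fpow_mul_natl] at hC1
  rw [e2, fpow_mul_natl, hΔ', zpowPair_zpow hY, zpowPair_mul_right] at hC2
  rw [fpow_mul_natl] at hD1
  rw [fpow_mul_natl, hΔ', zpowPair_zpow hY, zpowPair_mul_right] at hD2
  -- (C2) = (C1): the exponents agree
  have eC : (1 : ℤ) * l = l ∧ m * (l : ℤ) + -(j' : ℤ) = -j := by
    constructor
    · ring
    · linear_combination -hj'
  rw [eC.1, eC.2, ← hC1] at hC2
  -- hC2 : inl c' * (inl γ' * (inl c')⁻¹) = inl c * (inl γ * (inl c)⁻¹)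
  have hγγ' : c' * γ' * c'⁻¹ = c * γ * c⁻¹ := by
    have := hC2
    rw [← map_inv, ← map_inv, ← map_mul, ← map_mul, ← map_mul, ← map_mul, inl_inj] at this
    simpa only [mul_assoc] using this
  have hconj : γ' = (c'⁻¹ * c) * γ * (c'⁻¹ * c)⁻¹ := by
    have h3 : γ' = c'⁻¹ * (c * γ * c⁻¹) * c' := by rw [← hγγ']; group
    rw [h3]; group
  refine ⟨hconj, ?_⟩
  -- (D2) = (D1) · (C1)^(-n)
  have eD1 : (1 : ℤ) * -a' = -a + (l : ℤ) * -n := by linear_combination -ha'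
  have eY : ((frobElt σ ^ l : SD σ)) ^ (m * -a' + b') = (frobElt σ ^ l) ^ (b + -↑j * -n) := by
    rcases Nat.eq_zero_or_pos l with hl | hl
    · subst hl; simp
    · congr 1
      have hl' : (l : ℤ) ≠ 0 := by exact_mod_cast hl.ne'
      apply mul_right_cancel₀ hl'
      linear_combination hab' + a' * hj' + (j : ℤ) * ha' - hab
  rw [eD1, eY, ← zpowPair_mul hY, ← zpowPair_zpow hY, ← hC1, ← hD1] at hD2
  -- hD2 : inl c' * (F * (inl c')⁻¹) = inl c * (F * (inl c)⁻¹) * (inl c * (inl γ * (inl c)⁻¹)) ^ (-n)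
  have hz : (inl c * (inl γ * (inl c)⁻¹) : SD σ) ^ (-n) = inl c * (inl γ) ^ (-n) * (inl c)⁻¹ := by
    rw [← mul_assoc, ← MulAut.conj_apply, ← map_zpow, MulAut.conj_apply]
  rw [hz] at hD2
  -- isolate `σ γ^{-n} σ⁻¹ = g⁻¹ σ g σ⁻¹` with `g = c'⁻¹ c`
  have hD2' : (frobElt σ : SD σ) * inl γ ^ (-n) =
      (inl c)⁻¹ * inl c' * frobElt σ * ((inl c')⁻¹ * inl c) := by
    calc (frobElt σ : SD σ) * inl γ ^ (-n)
        = (inl c)⁻¹ * (inl c * (frobElt σ * (inl c)⁻¹) * (inl c * inl γ ^ (-n) * (inl c)⁻¹)) *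
            inl c := by group
      _ = (inl c)⁻¹ * (inl c' * (frobElt σ * (inl c')⁻¹)) * inl c := by rw [← hD2]
      _ = (inl c)⁻¹ * inl c' * frobElt σ * ((inl c')⁻¹ * inl c) := by group
  have hσγ : σ (γ ^ (-n)) = γ ^ (-n) := by
    have hγ1 : σ γ = γ := hγ
    rw [map_zpow, hγ1]
  rw [← map_zpow, frobElt_mul_inl, hσγ, ← map_inv, ← map_inv, ← map_mul, ← map_mul, mul_assoc,
    frobElt_mul_inl, ← mul_assoc, ← map_mul, mul_left_inj, inl_inj] at hD2'
  -- hD2' : γ ^ (-n) = c⁻¹ * c' * σ (c'⁻¹ * c)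
  rw [hD2', mul_inv_rev, inv_inv]

end HoldsProp2


section HoldsIndep

variable {G : Type u} [Group G]

/-- **Discharge of `Kottwitz1986BaseChangeUnits_2_indep_of_j_b`** («independent of `j, b`», p. 246):
the case `n = 0` of PROPOSITION 2. [cite: Kottwitz1986BaseChangeUnits, §2 pp. 246–247] -/
theorem Kottwitz1986BaseChangeUnits_2_indep_of_j_b_holds :
    ∀ {G : Type u} [Group G] (σ : MulAut G) (l : ℕ),
      Kottwitz1986BaseChangeUnits_2_indep_of_j_b σ l := by
  intro G _ σ l j j' a b b' m hab hab' hj' γ hγ γ' hγ' δ hδ hc hc'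
  obtain ⟨c, h1⟩ := hc
  obtain ⟨c', h2⟩ := hc'
  have ha : a = a + 0 * (l : ℤ) := by ring
  obtain ⟨hconj, hg⟩ := Kottwitz1986BaseChangeUnits_2_prop2_concrete_holds σ l j j' a b a b' 0 m
    hab hab' ha hj' γ hγ γ' hγ' δ hδ c c' h1 h2
  refine ⟨c'⁻¹ * c, ?_, hconj⟩
  rw [neg_zero, zpow_zero, inv_mul_eq_one] at hg
  exact hg.symm

end HoldsIndep

end Literature.NumberTheory.Kottwitz1986BaseChangeUnits.UnitBaseChange
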